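import Mathlib
import Literature.Computability.AlgebraicComplexity.LinSubst
import Summits.ValiantsHypothesis.ValiantsHypothesis.Theorems.BorderApolarityFixedWitnessObstructionQPInterp

/-!
# Border apolarity, crux `ToricWitnessObstructionQP` (stmt-ValiantsHypothesis-14753) — line `Sketch`,
# reshape 4: helper `snf_unusedComponent_mem` (bigrading by unused degree)

Route `ValiantsHypothesis/BorderApolarity`, crux item `stmt-ValiantsHypothesis-14753`
(`Summit.ValiantsHypothesis.ValiantsHypothesis.Theses.BorderApolarity.ToricWitnessObstructionQP`),
line `Sketch`, reshape 4 (structure of stable normal forms), wave-3 helper stub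
`snf_unusedComponent_mem`.

Let `ess : σ → Prop` single out the *own* variables (the others are *unused*) and let
`χ i := if ess i then 0 else 1` be the unused-degree weight.  If a subspace `J` of forms is stable
under the clean unused scalings `x_i ↦ x_i` (`ess i`), `x_i ↦ c • x_i` (`¬ ess i`) for all `c ≠ 0`,
i.e. under `linSubst (Matrix.diagonal fun i => if ess i then 1 else c)`, then `J` contains every
unused-degree component `weightedHomogeneousComponent χ r f` of each `f ∈ J`: the space `J` is
bigraded by (degree, unused degree).

Proof.  The clean scaling by `c` is the torus substitute `diag (c ^ χ)`
(`snfbg_diagonal_pow_indicator`), which multiplies the `χ`-weight-`r` component by `c ^ r`.  With `N`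
a bound for the `χ`-weights of the monomials of `f`, Vandermonde interpolation at the nonzero nodes
`1, …, N + 1` writes each component as a `ℂ`-linear combination of the substitutes
`diag ((j + 1) ^ χ) · f ∈ J` (`BorderApolarityFixedWitnessObstructionQP.stub_interp`), hence it lies
in `J`.  (The hypothesis that `J` consists of degree-`k` forms is not needed for this step.)
-/

open MvPolynomial Filter
open scoped BigOperators Matrix
open Literature.Computability.AlgebraicComplexity

-- the mandated summit-side namespace repeats a component by design (single-problem summit)
set_option linter.dupNamespace false

namespace Summit.ValiantsHypothesis.ValiantsHypothesis.Theorems.BorderApolarityToricWitnessObstructionQP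

/-- The clean unused scaling by `c` is the torus substitute `diag (c ^ χ)` for the `0/1` weight
`χ i := if ess i then 0 else 1`: `c ^ χ i = if ess i then 1 else c`. [folklore] -/
theorem snfbg_diagonal_pow_indicator {σ : Type*} [DecidableEq σ] (ess : σ → Prop)
    [DecidablePred ess] (c : ℂ) :
    (Matrix.diagonal fun i => c ^ (if ess i then (0 : ℕ) else 1)) =
      Matrix.diagonal fun i => if ess i then (1 : ℂ) else c := by
  congr 1
  funext i
  split_ifs <;> simp

/-- Stability under the clean unused scalings gives the torus substitutes at the nodes `c ≠ 0`:
`linSubst (diag (c ^ χ)) f ∈ J` for `f ∈ J`. [folklore] -/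
theorem snfbg_linSubst_torus_mem {σ : Type*} [Fintype σ] [DecidableEq σ] (ess : σ → Prop)
    [DecidablePred ess] (J : Submodule ℂ (MvPolynomial σ ℂ))
    (hstab : ∀ c : ℂ, c ≠ 0 → ∀ f ∈ J,
      linSubst σ ℂ (Matrix.diagonal fun i => if ess i then 1 else c) f ∈ J)
    (c : ℂ) (hc : c ≠ 0) (f : MvPolynomial σ ℂ) (hf : f ∈ J) :
    linSubst σ ℂ (Matrix.diagonal fun i => c ^ (if ess i then (0 : ℕ) else 1)) f ∈ J := by
  rw [snfbg_diagonal_pow_indicator ess c]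
  exact hstab c hc f hf

/-- **Bigrading by unused degree from the clean unused scalings.**  If `J` is stable under
`linSubst (Matrix.diagonal fun i => if ess i then 1 else c)` for all `c ≠ 0`, then every
unused-degree component `weightedHomogeneousComponent χ r f` (`χ i := if ess i then 0 else 1`) of
every `f ∈ J` lies in `J`: the clean scaling by `c` multiplies the `χ`-weight-`r` component by
`c ^ r`, and Vandermonde interpolation at the nonzero nodes `1, …, N + 1` (`N` a bound for the
`χ`-weights of the monomials of `f`) expresses each component through the substitutes
`diag ((j + 1) ^ χ) · f ∈ J`.  The degree-`k` hypothesis on `J` is not used. [folklore] -/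
theorem snf_unusedComponent_mem : ∀ {σ : Type} [Fintype σ] [DecidableEq σ] (ess : σ → Prop)
    [DecidablePred ess] (J : Submodule ℂ (MvPolynomial σ ℂ)) (k : ℕ),
    J ≤ MvPolynomial.homogeneousSubmodule σ ℂ k →
    (∀ c : ℂ, c ≠ 0 → ∀ f ∈ J, linSubst σ ℂ (Matrix.diagonal fun i => if ess i then 1 else c) f ∈ J) →
    ∀ f ∈ J, ∀ r : ℕ, weightedHomogeneousComponent (fun i => if ess i then (0 : ℕ) else 1) r f ∈ J := by
  intro σ _ _ ess _ J k _hJ hstab f hf r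
  obtain ⟨a, ha⟩ := BorderApolarityFixedWitnessObstructionQP.stub_interp σ
    (fun i => if ess i then (0 : ℕ) else 1)
    (f.support.sup fun d => Finsupp.weight (fun i => if ess i then (0 : ℕ) else 1) d) r f
    (fun d hd => Finset.le_sup
      (f := fun d => Finsupp.weight (fun i => if ess i then (0 : ℕ) else 1) d) hd)
  rw [ha]
  refine J.sum_mem fun j _ => J.smul_mem _ ?_
  exact snfbg_linSubst_torus_mem ess J hstab _ (Nat.cast_add_one_ne_zero _) f hf

end Summit.ValiantsHypothesis.ValiantsHypothesis.Theorems.BorderApolarityToricWitnessObstructionQP
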